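import Summits.QuantumFields.YangMills.Theorems.BalabanLadderIRTwistedSlabSliceStokes
import Summits.QuantumFields.YangMills.Theorems.BalabanLadderIRTwistedSlabDefs
import Literature.MathematicalPhysics.QuantumLattice.TwistEaterIrreducibility
import HarnessLib

/-!
# The orthogonally twisted slab has NO zero-action configuration (magnetic twist `z` on `(0,1)`, electric `z^k ≠ 1` on `(2,3)`)

HELPER toward stub **T1** `TwistedSlabAnchor` (LINE `twisted-slab-continuity`, crux `IRcof` stmt-QuantumFields-26930, census row 43; LEAD prover
ym-ir-line-tsc-p1; `--supports` the crux, `--as helper`).  Second file of the programme «the e₂-projection in T1 is LOAD-BEARING» (memo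
`Cruxes/IRcof/T1-ANATOMY-tsc-p1.md`): the β → ∞ skeleton of T1's vacuum structure.

WHAT IS PROVED, for the ANISOTROPIC `Fin` boxes `n₀ × n₁ × n₂ × n₃` (all sides `≥ 1`) of the line's currency
`wilsonFinTorusTensorTwistedPartition`, twist tensor `tHooftTwistTensor (slabTwist zM zE)` (stack `x_μ = x_ν = 0`):
* `slice_holonomy_comm` — for a TWISTED-FLAT configuration (`w_x · U_p(x) = 1` on every plaquette) and every plane `μ < ν`, the based
  Polyakov holonomies of any periodic 2-torus slice satisfy `H_ν H_μ H_ν⁻¹ H_μ⁻¹ = (∏ plaquette twists of the slice)⁻¹⁻¹`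
  (`torus_holonomy_comm_eq` of `…SliceStokes`); `lprod_lprod_twist_eq` — that product is the single stack entry `w μ ν`.
* ★ `no_twistedFlat_slab` — ANY group `G`, central `zM`, central `zE ≠ 1`, and the ISOLATION hypothesis «every element commuting with a pair of
  commutator `zM` is central» (`SU(N)` with `zM` generating `Z_N`: Schur, lit-4's `exists_eq_smul_one_of_commute_pair`): NO configuration of
  the box has all twisted plaquettes trivial.  Mechanism ('t Hooft 1979 §3; van Baal 1982; González-Arroyo 1998 §8.1 «zero-action solutions
  only for orthogonal twists»): the four based holonomies `H₀…H₃` at the origin have `H₁H₀H₁⁻¹H₀⁻¹ = zM`, `H₃H₂H₃⁻¹H₂⁻¹ = zE` and commute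
  across the four mixed planes; isolation makes `H₂, H₃` central, so `zE = 1`.
* `centralizer_central_of_suCenter` — the isolation hypothesis for `SU(N)`, `zM = ω^k·1` with `k` a unit of `ℤ/N` (lit-4, p653142);
  ★ `no_twistedFlat_slab_specialUnitary` — the `SU(N)` statement.
Consequence used downstream (`…ClassicalRate`, next file): the doubly twisted slab has strictly positive minimal Wilson action, hence
`W{z, z^k}(β)/W{z, 1}(β) → 0` as `β → ∞` at fixed box — the `N` vacua of the unprojected twisted slab (e₂-flux degeneracy in the classical
limit), i.e. why T1 carries the e₂-projection.

HONEST FRAMING: lattice group algebra on one box; nothing here bears on `IRcof`, `IR`, or the Yang–Mills mass gap (Clay: NOT proved);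
R4 = `BalabanLadder.UV` only.  References: 't Hooft NPB 153 (1979) §3; van Baal CMP 85 (1982) 529; González-Arroyo hep-th/9807108 §4.2, §8.1;
García Pérez–González-Arroyo–Okawa, Int. J. Mod. Phys. A 29 (2014) §2.
-/

set_option autoImplicit false

open Literature.MathematicalPhysics.QuantumFieldTheory
-- the coercion `ℕ → Fin (m+1)` (value `mod (m+1)`) parametrises periodic slices by natural numbers
open Fin.NatCast

namespace Summit.QuantumFields.YangMills.Cruxes.IRcof.TwistedSlab

variable {G : Type*} [Group G]

/-! ## §1 Two more facts on ordered products -/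

/-- An ordered product over `m < a` all of whose factors but the `k`-th are `1` equals that factor. [folklore] -/
theorem lprod_eq_single {f : ℕ → G} {k a : ℕ} (hk : k < a) (hf : ∀ m, m < a → m ≠ k → f m = 1) :
    lprod f a = f k := by
  rw [lprod_congr (g := fun m => if m = k then f k else 1) (fun m hm => by
    by_cases h : m = k
    · rw [h, if_pos rfl]
    · rw [if_neg h, hf m hm h])]
  rw [lprod_eq_of_eq_one_off (k := k) (fun m hm => if_neg hm) hk, if_pos rfl]

/-- An ordered product of `1`s (on the range read) is `1`. [folklore] -/
theorem lprod_eq_one {f : ℕ → G} {a : ℕ} (hf : ∀ m, m < a → f m = 1) : lprod f a = 1 :=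
  lprod_eq_one_of_forall_lt hf

/-! ## §2 One slice of a twisted-flat `Fin` box -/

section FinBox

variable {n₀ n₁ n₂ n₃ : ℕ}

/-- Every entry of 't Hooft's twist tensor field is central when the tensor is. [folklore] -/
theorem tHooftTwistTensor_mem_center {w : Fin 4 → Fin 4 → G} (hw : ∀ μ ν, w μ ν ∈ Subgroup.center G)
    (x : FinTorusSite n₀ n₁ n₂ n₃) (μ ν : Fin 4) : tHooftTwistTensor w x μ ν ∈ Subgroup.center G := by
  unfold tHooftTwistTensor
  split_ifs
  · exact hw μ ν
  · exact Subgroup.one_mem _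

/-- **One periodic 2-torus slice of a twisted-flat box.**  If every twisted plaquette holonomy is trivial (`w_x · U_p(x) = 1`) and
`emb : ℕ × ℕ → sites` parametrises a slice on which the shifts in the directions `μ < ν` act as `i ↦ i+1`, `j ↦ j+1`, periodically
(`emb a j = emb 0 j`, `emb i b = emb i 0`), then the based holonomies `H_μ = U(emb 0 0, μ) ⋯ U(emb (a−1) 0, μ)`,
`H_ν = U(emb 0 0, ν) ⋯ U(emb 0 (b−1), ν)` satisfy `H_ν H_μ H_ν⁻¹ H_μ⁻¹ = (∏_{j<b} ∏_{i<a} (w_{emb i j})⁻¹)⁻¹`. [folklore] -/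
theorem slice_holonomy_comm (U : FinTorusSite n₀ n₁ n₂ n₃ × Fin 4 → G) {w : Fin 4 → Fin 4 → G}
    (hw : ∀ μ ν, w μ ν ∈ Subgroup.center G)
    (hflat : ∀ (x : FinTorusSite n₀ n₁ n₂ n₃) (μ ν : Fin 4), μ < ν →
      tHooftTwistTensor w x μ ν * finTorusPlaquette U x μ ν = 1)
    {μ ν : Fin 4} (hμν : μ < ν) {a b : ℕ} (emb : ℕ → ℕ → FinTorusSite n₀ n₁ n₂ n₃)
    (hμs : ∀ i j, (emb i j).shift μ = emb (i + 1) j) (hνs : ∀ i j, (emb i j).shift ν = emb i (j + 1))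
    (ha : ∀ j, emb a j = emb 0 j) (hb : ∀ i, emb i b = emb i 0) :
    lprod (fun j => U (emb 0 j, ν)) b * lprod (fun i => U (emb i 0, μ)) a *
        (lprod (fun j => U (emb 0 j, ν)) b)⁻¹ * (lprod (fun i => U (emb i 0, μ)) a)⁻¹ =
      (lprod (fun j => lprod (fun i => (tHooftTwistTensor w (emb i j) μ ν)⁻¹) a) b)⁻¹ :=
  torus_holonomy_comm_eq (u := fun i j => U (emb i j, μ)) (v := fun i j => U (emb i j, ν))
    (c := fun i j => (tHooftTwistTensor w (emb i j) μ ν)⁻¹)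
    (fun i j => Subgroup.inv_mem _ (tHooftTwistTensor_mem_center hw _ _ _))
    (fun i j => by
      have h := hflat (emb i j) μ ν hμν
      unfold finTorusPlaquette at h
      rw [hμs, hνs] at h
      exact eq_inv_of_mul_eq_one_right h)
    (fun j => by simp only [ha]) (fun i _ => by simp only [hb])

/-- **The twist product of a slice through the stack is the stack entry.**  If on the window `i < a`, `j < b` the slice meets the twist
stack exactly at `(0,0)`, then `∏_{j<b} ∏_{i<a} (w_{emb i j})⁻¹ = (w μ ν)⁻¹`. [folklore] -/
theorem lprod_lprod_twist_eq {w : Fin 4 → Fin 4 → G} {μ ν : Fin 4} {a b : ℕ} (ha : 0 < a) (hb : 0 < b)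
    (emb : ℕ → ℕ → FinTorusSite n₀ n₁ n₂ n₃)
    (hcoord : ∀ i j, i < a → j < b →
      ((finTorusSiteCoord (emb i j) μ = 0 ∧ finTorusSiteCoord (emb i j) ν = 0) ↔ (i = 0 ∧ j = 0))) :
    lprod (fun j => lprod (fun i => (tHooftTwistTensor w (emb i j) μ ν)⁻¹) a) b = (w μ ν)⁻¹ := by
  have hrow : ∀ j, j < b → lprod (fun i => (tHooftTwistTensor w (emb i j) μ ν)⁻¹) a =
      if j = 0 then (w μ ν)⁻¹ else 1 := by
    intro j hj
    by_cases hj0 : j = 0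
    · subst hj0
      rw [if_pos rfl, lprod_eq_single (k := 0) ha (fun m hm hm0 => ?_)]
      · unfold tHooftTwistTensor
        rw [if_pos ((hcoord 0 0 ha hb).2 ⟨rfl, rfl⟩)]
      · unfold tHooftTwistTensor
        rw [if_neg (fun h => hm0 ((hcoord m 0 hm hb).1 h).1), inv_one]
    · rw [if_neg hj0]
      refine lprod_eq_one fun m hm => ?_
      unfold tHooftTwistTensor
      rw [if_neg (fun h => hj0 ((hcoord m j hm hj).1 h).2), inv_one]
  rw [lprod_congr (g := fun j => if j = 0 then (w μ ν)⁻¹ else 1) hrow,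
    lprod_eq_of_eq_one_off (k := 0) (fun m hm => if_neg hm) hb, if_pos rfl]

end FinBox

/-! ## §3 The slab: four holonomies, six planes, no flat configuration -/

section Slab

variable {m₀ m₁ m₂ m₃ : ℕ}

/-- Coordinates of a site given by natural-number casts (all sides `m_i + 1 ≥ 1`). [folklore] -/
private theorem coord_cast (i₀ i₁ i₂ i₃ : ℕ) :
    finTorusSiteCoord (((i₀ : Fin (m₀ + 1)), (i₁ : Fin (m₁ + 1)), (i₂ : Fin (m₂ + 1)), (i₃ : Fin (m₃ + 1))) :
        FinTorusSite (m₀ + 1) (m₁ + 1) (m₂ + 1) (m₃ + 1)) =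
      ![i₀ % (m₀ + 1), i₁ % (m₁ + 1), i₂ % (m₂ + 1), i₃ % (m₃ + 1)] := by
  unfold finTorusSiteCoord
  simp

/-- The four shifts of a cast site: `+1` on the shifted coordinate. [folklore] -/
private theorem shift_cast (i₀ i₁ i₂ i₃ : ℕ) :
    FinTorusSite.shift ((((i₀ : Fin (m₀ + 1)), (i₁ : Fin (m₁ + 1)), (i₂ : Fin (m₂ + 1)), (i₃ : Fin (m₃ + 1))) :
        FinTorusSite (m₀ + 1) (m₁ + 1) (m₂ + 1) (m₃ + 1))) 0 =
      (((i₀ + 1 : ℕ) : Fin (m₀ + 1)), (i₁ : Fin (m₁ + 1)), (i₂ : Fin (m₂ + 1)), (i₃ : Fin (m₃ + 1))) ∧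
    FinTorusSite.shift ((((i₀ : Fin (m₀ + 1)), (i₁ : Fin (m₁ + 1)), (i₂ : Fin (m₂ + 1)), (i₃ : Fin (m₃ + 1))) :
        FinTorusSite (m₀ + 1) (m₁ + 1) (m₂ + 1) (m₃ + 1))) 1 =
      ((i₀ : Fin (m₀ + 1)), ((i₁ + 1 : ℕ) : Fin (m₁ + 1)), (i₂ : Fin (m₂ + 1)), (i₃ : Fin (m₃ + 1))) ∧
    FinTorusSite.shift ((((i₀ : Fin (m₀ + 1)), (i₁ : Fin (m₁ + 1)), (i₂ : Fin (m₂ + 1)), (i₃ : Fin (m₃ + 1))) :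
        FinTorusSite (m₀ + 1) (m₁ + 1) (m₂ + 1) (m₃ + 1))) 2 =
      ((i₀ : Fin (m₀ + 1)), (i₁ : Fin (m₁ + 1)), ((i₂ + 1 : ℕ) : Fin (m₂ + 1)), (i₃ : Fin (m₃ + 1))) ∧
    FinTorusSite.shift ((((i₀ : Fin (m₀ + 1)), (i₁ : Fin (m₁ + 1)), (i₂ : Fin (m₂ + 1)), (i₃ : Fin (m₃ + 1))) :
        FinTorusSite (m₀ + 1) (m₁ + 1) (m₂ + 1) (m₃ + 1))) 3 =
      ((i₀ : Fin (m₀ + 1)), (i₁ : Fin (m₁ + 1)), (i₂ : Fin (m₂ + 1)), ((i₃ + 1 : ℕ) : Fin (m₃ + 1))) := by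
  refine ⟨?_, ?_, ?_, ?_⟩ <;>
    simp [FinTorusSite.shift, finRotate_apply, Nat.cast_succ]

/-- The window condition: for `i < m + 1`, `(i : Fin (m+1))` has coordinate `i`. [folklore] -/
private theorem mod_window {i m : ℕ} (hi : i < m + 1) : i % (m + 1) = i := Nat.mod_eq_of_lt hi

/-- ★ **THE ORTHOGONALLY TWISTED SLAB HAS NO ZERO-ACTION CONFIGURATION.**  Let `G` be any group, `zM ∈ Z(G)`, `zE ∈ Z(G)` with
`zE ≠ 1`, and suppose `zM` is ISOLATING in the strong sense that every element commuting with a pair `(A, B)` of commutator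
`B A B⁻¹ A⁻¹ = zM` is central (for `SU(N)` and `zM` a generator of `Z_N`: Schur's lemma for the irreducible twist-eating pair).  Then on
every box `(m₀+1) × (m₁+1) × (m₂+1) × (m₃+1)` NO configuration makes all plaquettes of the slab twist `slabTwist zM zE` (magnetic `zM` on
`(0,1)`, electric `zE` on `(2,3)`) trivial: the based holonomies at the origin would satisfy `H₁H₀H₁⁻¹H₀⁻¹ = zM`,
`[H₂, H₀] = [H₂, H₁] = [H₃, H₀] = [H₃, H₁] = 1` (so `H₂, H₃` are central) and `H₃H₂H₃⁻¹H₂⁻¹ = zE ≠ 1`.  ('t Hooft: orthogonal twists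
`n₀₁ n₂₃ ≢ 0` admit no flat connection; on the lattice «instantons cannot fall through».) [folklore] -/
theorem no_twistedFlat_slab {zM zE : G} (hM : zM ∈ Subgroup.center G) (hEc : zE ∈ Subgroup.center G) (hE1 : zE ≠ 1)
    (hcent : ∀ A B M : G, B * A * B⁻¹ * A⁻¹ = zM → M * A * M⁻¹ * A⁻¹ = 1 → M * B * M⁻¹ * B⁻¹ = 1 →
      M ∈ Subgroup.center G)
    (U : FinTorusSite (m₀ + 1) (m₁ + 1) (m₂ + 1) (m₃ + 1) × Fin 4 → G) :
    ¬ ∀ (x : FinTorusSite (m₀ + 1) (m₁ + 1) (m₂ + 1) (m₃ + 1)) (μ ν : Fin 4), μ < ν →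
        tHooftTwistTensor (slabTwist zM zE) x μ ν * finTorusPlaquette U x μ ν = 1 := by
  intro hflat
  have hw : ∀ μ ν, slabTwist zM zE μ ν ∈ Subgroup.center G := fun μ ν => by
    unfold slabTwist
    split_ifs
    · exact hM
    · exact hEc
    · exact Subgroup.one_mem _
  -- generic slice evaluation: `Hν Hμ Hν⁻¹ Hμ⁻¹ = slabTwist zM zE μ ν`
  have hslice : ∀ {μ ν : Fin 4} (_ : μ < ν) {a b : ℕ} (_ : 0 < a) (_ : 0 < b)
      (emb : ℕ → ℕ → FinTorusSite (m₀ + 1) (m₁ + 1) (m₂ + 1) (m₃ + 1))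
      (_ : ∀ i j, (emb i j).shift μ = emb (i + 1) j) (_ : ∀ i j, (emb i j).shift ν = emb i (j + 1))
      (_ : ∀ j, emb a j = emb 0 j) (_ : ∀ i, emb i b = emb i 0)
      (_ : ∀ i j, i < a → j < b →
        ((finTorusSiteCoord (emb i j) μ = 0 ∧ finTorusSiteCoord (emb i j) ν = 0) ↔ (i = 0 ∧ j = 0))),
      lprod (fun j => U (emb 0 j, ν)) b * lprod (fun i => U (emb i 0, μ)) a *
        (lprod (fun j => U (emb 0 j, ν)) b)⁻¹ * (lprod (fun i => U (emb i 0, μ)) a)⁻¹ = slabTwist zM zE μ ν := by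
    intro μ ν hμν a b ha0 hb0 emb hμs hνs ha hb hcoord
    rw [slice_holonomy_comm U hw hflat hμν emb hμs hνs ha hb, lprod_lprod_twist_eq ha0 hb0 emb hcoord, inv_inv]
  -- the six planes through the origin (holonomies `H₀ … H₃` written out; `↑(0:ℕ)` normalised to `0` by `simpa`)
  have h01 : lprod (fun j => U (((0 : Fin (m₀ + 1)), (j : Fin (m₁ + 1)), (0 : Fin (m₂ + 1)), (0 : Fin (m₃ + 1))), 1)) (m₁ + 1) *
      lprod (fun i => U (((i : Fin (m₀ + 1)), (0 : Fin (m₁ + 1)), (0 : Fin (m₂ + 1)), (0 : Fin (m₃ + 1))), 0)) (m₀ + 1) *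
      (lprod (fun j => U (((0 : Fin (m₀ + 1)), (j : Fin (m₁ + 1)), (0 : Fin (m₂ + 1)), (0 : Fin (m₃ + 1))), 1)) (m₁ + 1))⁻¹ *
      (lprod (fun i => U (((i : Fin (m₀ + 1)), (0 : Fin (m₁ + 1)), (0 : Fin (m₂ + 1)), (0 : Fin (m₃ + 1))), 0)) (m₀ + 1))⁻¹ = zM := by
    have h := hslice (μ := 0) (ν := 1) (by decide) (Nat.succ_pos m₀) (Nat.succ_pos m₁)
      (fun i j : ℕ => ((i : Fin (m₀ + 1)), (j : Fin (m₁ + 1)), ((0 : ℕ) : Fin (m₂ + 1)), ((0 : ℕ) : Fin (m₃ + 1))))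
      (fun i j => (shift_cast i j 0 0).1) (fun i j => (shift_cast i j 0 0).2.1)
      (fun j => by simp) (fun i => by simp)
      (fun i j hi hj => by rw [coord_cast]; simp [mod_window hi, mod_window hj])
    simpa [slabTwist] using h
  have h23 : lprod (fun j => U (((0 : Fin (m₀ + 1)), (0 : Fin (m₁ + 1)), (0 : Fin (m₂ + 1)), (j : Fin (m₃ + 1))), 3)) (m₃ + 1) *
      lprod (fun i => U (((0 : Fin (m₀ + 1)), (0 : Fin (m₁ + 1)), (i : Fin (m₂ + 1)), (0 : Fin (m₃ + 1))), 2)) (m₂ + 1) *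
      (lprod (fun j => U (((0 : Fin (m₀ + 1)), (0 : Fin (m₁ + 1)), (0 : Fin (m₂ + 1)), (j : Fin (m₃ + 1))), 3)) (m₃ + 1))⁻¹ *
      (lprod (fun i => U (((0 : Fin (m₀ + 1)), (0 : Fin (m₁ + 1)), (i : Fin (m₂ + 1)), (0 : Fin (m₃ + 1))), 2)) (m₂ + 1))⁻¹ = zE := by
    have h := hslice (μ := 2) (ν := 3) (by decide) (Nat.succ_pos m₂) (Nat.succ_pos m₃)
      (fun i j : ℕ => (((0 : ℕ) : Fin (m₀ + 1)), ((0 : ℕ) : Fin (m₁ + 1)), (i : Fin (m₂ + 1)), (j : Fin (m₃ + 1))))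
      (fun i j => (shift_cast 0 0 i j).2.2.1) (fun i j => (shift_cast 0 0 i j).2.2.2)
      (fun j => by simp) (fun i => by simp)
      (fun i j hi hj => by rw [coord_cast]; simp [mod_window hi, mod_window hj])
    simpa [slabTwist] using h
  have h02 : lprod (fun j => U (((0 : Fin (m₀ + 1)), (0 : Fin (m₁ + 1)), (j : Fin (m₂ + 1)), (0 : Fin (m₃ + 1))), 2)) (m₂ + 1) *
      lprod (fun i => U (((i : Fin (m₀ + 1)), (0 : Fin (m₁ + 1)), (0 : Fin (m₂ + 1)), (0 : Fin (m₃ + 1))), 0)) (m₀ + 1) *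
      (lprod (fun j => U (((0 : Fin (m₀ + 1)), (0 : Fin (m₁ + 1)), (j : Fin (m₂ + 1)), (0 : Fin (m₃ + 1))), 2)) (m₂ + 1))⁻¹ *
      (lprod (fun i => U (((i : Fin (m₀ + 1)), (0 : Fin (m₁ + 1)), (0 : Fin (m₂ + 1)), (0 : Fin (m₃ + 1))), 0)) (m₀ + 1))⁻¹ = 1 := by
    have h := hslice (μ := 0) (ν := 2) (by decide) (Nat.succ_pos m₀) (Nat.succ_pos m₂)
      (fun i j : ℕ => ((i : Fin (m₀ + 1)), ((0 : ℕ) : Fin (m₁ + 1)), (j : Fin (m₂ + 1)), ((0 : ℕ) : Fin (m₃ + 1))))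
      (fun i j => (shift_cast i 0 j 0).1) (fun i j => (shift_cast i 0 j 0).2.2.1)
      (fun j => by simp) (fun i => by simp)
      (fun i j hi hj => by rw [coord_cast]; simp [mod_window hi, mod_window hj])
    simpa [slabTwist] using h
  have h03 : lprod (fun j => U (((0 : Fin (m₀ + 1)), (0 : Fin (m₁ + 1)), (0 : Fin (m₂ + 1)), (j : Fin (m₃ + 1))), 3)) (m₃ + 1) *
      lprod (fun i => U (((i : Fin (m₀ + 1)), (0 : Fin (m₁ + 1)), (0 : Fin (m₂ + 1)), (0 : Fin (m₃ + 1))), 0)) (m₀ + 1) *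
      (lprod (fun j => U (((0 : Fin (m₀ + 1)), (0 : Fin (m₁ + 1)), (0 : Fin (m₂ + 1)), (j : Fin (m₃ + 1))), 3)) (m₃ + 1))⁻¹ *
      (lprod (fun i => U (((i : Fin (m₀ + 1)), (0 : Fin (m₁ + 1)), (0 : Fin (m₂ + 1)), (0 : Fin (m₃ + 1))), 0)) (m₀ + 1))⁻¹ = 1 := by
    have h := hslice (μ := 0) (ν := 3) (by decide) (Nat.succ_pos m₀) (Nat.succ_pos m₃)
      (fun i j : ℕ => ((i : Fin (m₀ + 1)), ((0 : ℕ) : Fin (m₁ + 1)), ((0 : ℕ) : Fin (m₂ + 1)), (j : Fin (m₃ + 1))))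
      (fun i j => (shift_cast i 0 0 j).1) (fun i j => (shift_cast i 0 0 j).2.2.2)
      (fun j => by simp) (fun i => by simp)
      (fun i j hi hj => by rw [coord_cast]; simp [mod_window hi, mod_window hj])
    simpa [slabTwist] using h
  have h12 : lprod (fun j => U (((0 : Fin (m₀ + 1)), (0 : Fin (m₁ + 1)), (j : Fin (m₂ + 1)), (0 : Fin (m₃ + 1))), 2)) (m₂ + 1) *
      lprod (fun i => U (((0 : Fin (m₀ + 1)), (i : Fin (m₁ + 1)), (0 : Fin (m₂ + 1)), (0 : Fin (m₃ + 1))), 1)) (m₁ + 1) *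
      (lprod (fun j => U (((0 : Fin (m₀ + 1)), (0 : Fin (m₁ + 1)), (j : Fin (m₂ + 1)), (0 : Fin (m₃ + 1))), 2)) (m₂ + 1))⁻¹ *
      (lprod (fun i => U (((0 : Fin (m₀ + 1)), (i : Fin (m₁ + 1)), (0 : Fin (m₂ + 1)), (0 : Fin (m₃ + 1))), 1)) (m₁ + 1))⁻¹ = 1 := by
    have h := hslice (μ := 1) (ν := 2) (by decide) (Nat.succ_pos m₁) (Nat.succ_pos m₂)
      (fun i j : ℕ => (((0 : ℕ) : Fin (m₀ + 1)), (i : Fin (m₁ + 1)), (j : Fin (m₂ + 1)), ((0 : ℕ) : Fin (m₃ + 1))))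
      (fun i j => (shift_cast 0 i j 0).2.1) (fun i j => (shift_cast 0 i j 0).2.2.1)
      (fun j => by simp) (fun i => by simp)
      (fun i j hi hj => by rw [coord_cast]; simp [mod_window hi, mod_window hj])
    simpa [slabTwist] using h
  have h13 : lprod (fun j => U (((0 : Fin (m₀ + 1)), (0 : Fin (m₁ + 1)), (0 : Fin (m₂ + 1)), (j : Fin (m₃ + 1))), 3)) (m₃ + 1) *
      lprod (fun i => U (((0 : Fin (m₀ + 1)), (i : Fin (m₁ + 1)), (0 : Fin (m₂ + 1)), (0 : Fin (m₃ + 1))), 1)) (m₁ + 1) *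
      (lprod (fun j => U (((0 : Fin (m₀ + 1)), (0 : Fin (m₁ + 1)), (0 : Fin (m₂ + 1)), (j : Fin (m₃ + 1))), 3)) (m₃ + 1))⁻¹ *
      (lprod (fun i => U (((0 : Fin (m₀ + 1)), (i : Fin (m₁ + 1)), (0 : Fin (m₂ + 1)), (0 : Fin (m₃ + 1))), 1)) (m₁ + 1))⁻¹ = 1 := by
    have h := hslice (μ := 1) (ν := 3) (by decide) (Nat.succ_pos m₁) (Nat.succ_pos m₃)
      (fun i j : ℕ => (((0 : ℕ) : Fin (m₀ + 1)), (i : Fin (m₁ + 1)), ((0 : ℕ) : Fin (m₂ + 1)), (j : Fin (m₃ + 1))))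
      (fun i j => (shift_cast 0 i 0 j).2.1) (fun i j => (shift_cast 0 i 0 j).2.2.2)
      (fun j => by simp) (fun i => by simp)
      (fun i j hi hj => by rw [coord_cast]; simp [mod_window hi, mod_window hj])
    simpa [slabTwist] using h
  -- isolation: `H₂`, `H₃` commute with the twist-eating pair `(H₀, H₁)`, hence are central, hence commute with each other
  have hH2 := hcent _ _ _ h01 h02 h12
  have hH3 := hcent _ _ _ h01 h03 h13
  have hcomm : lprod (fun j => U (((0 : Fin (m₀ + 1)), (0 : Fin (m₁ + 1)), (0 : Fin (m₂ + 1)), (j : Fin (m₃ + 1))), 3)) (m₃ + 1) *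
      lprod (fun i => U (((0 : Fin (m₀ + 1)), (0 : Fin (m₁ + 1)), (i : Fin (m₂ + 1)), (0 : Fin (m₃ + 1))), 2)) (m₂ + 1) *
      (lprod (fun j => U (((0 : Fin (m₀ + 1)), (0 : Fin (m₁ + 1)), (0 : Fin (m₂ + 1)), (j : Fin (m₃ + 1))), 3)) (m₃ + 1))⁻¹ *
      (lprod (fun i => U (((0 : Fin (m₀ + 1)), (0 : Fin (m₁ + 1)), (i : Fin (m₂ + 1)), (0 : Fin (m₃ + 1))), 2)) (m₂ + 1))⁻¹ = 1 := by
    have hc := Subgroup.mem_center_iff.mp hH2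
      (lprod (fun j => U (((0 : Fin (m₀ + 1)), (0 : Fin (m₁ + 1)), (0 : Fin (m₂ + 1)), (j : Fin (m₃ + 1))), 3)) (m₃ + 1))
    rw [hc]; group
  exact hE1 (h23.symm.trans hcomm)

end Slab

/-! ## §4 `SU(N)`: a generating centre element is isolating (lit-4's Schur lemma for Weyl–'t Hooft pairs) -/

section SpecialUnitary

open Literature.MathematicalPhysics.QuantumLattice

variable {N : ℕ}

/-- Elements of `SU(N)` are invertible matrices. [folklore] -/
private theorem isUnit_coe_SU (A : Matrix.specialUnitaryGroup (Fin N) ℂ) : IsUnit (A : Matrix (Fin N) (Fin N) ℂ) :=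
  ⟨⟨(A : Matrix (Fin N) (Fin N) ℂ), star (A : Matrix (Fin N) (Fin N) ℂ), A.prop.1.2, A.prop.1.1⟩, rfl⟩

variable [NeZero N]

/-- **In `SU(N)`, every element commuting with a pair whose commutator is a GENERATING centre element is central** (`k` a unit of
`ℤ/N`): the pair `B A = ω^k · A B`, `ω^k` a primitive `N`-th root, is irreducible (lit-4's `exists_eq_smul_one_of_commute_pair`,
González-Arroyo 1998 §4.2 ∕ Schwinger), so the commuting element is a scalar matrix. [cite: Gonzalezarroyo1998, §4.2] -/
theorem centralizer_central_of_suCenter {k : ZMod N} (hk : IsUnit k) (A B M : Matrix.specialUnitaryGroup (Fin N) ℂ)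
    (hAB : B * A * B⁻¹ * A⁻¹ = (suCenter N k : Matrix.specialUnitaryGroup (Fin N) ℂ))
    (hMA : M * A * M⁻¹ * A⁻¹ = 1) (hMB : M * B * M⁻¹ * B⁻¹ = 1) :
    M ∈ Subgroup.center (Matrix.specialUnitaryGroup (Fin N) ℂ) := by
  -- matrix-level relations `B A = ω^k · A B`, `M B = B M`, `M A = A M`
  have hBAm : (B : Matrix (Fin N) (Fin N) ℂ) * A = centerPhase N k • ((A : Matrix (Fin N) (Fin N) ℂ) * B) := by
    have h1 : B * A = (suCenter N k : Matrix.specialUnitaryGroup (Fin N) ℂ) * (A * B) := by rw [← hAB]; group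
    have h2 := congrArg Subtype.val h1
    change (B : Matrix (Fin N) (Fin N) ℂ) * A =
      (centerPhase N k • (1 : Matrix (Fin N) (Fin N) ℂ)) * ((A : Matrix (Fin N) (Fin N) ℂ) * B) at h2
    rwa [Matrix.smul_mul, Matrix.one_mul] at h2
  have hMBm : (M : Matrix (Fin N) (Fin N) ℂ) * B = (B : Matrix (Fin N) (Fin N) ℂ) * M := by
    have h1 : M * B = B * M := by
      calc M * B = (M * B * M⁻¹ * B⁻¹) * (B * M) := by group
        _ = B * M := by rw [hMB, one_mul]
    exact congrArg Subtype.val h1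
  have hMAm : (M : Matrix (Fin N) (Fin N) ℂ) * A = (A : Matrix (Fin N) (Fin N) ℂ) * M := by
    have h1 : M * A = A * M := by
      calc M * A = (M * A * M⁻¹ * A⁻¹) * (A * M) := by group
        _ = A * M := by rw [hMA, one_mul]
    exact congrArg Subtype.val h1
  obtain ⟨c, hc⟩ := exists_eq_smul_one_of_commute_pair (isUnit_coe_SU B) (isUnit_coe_SU A)
    (isPrimitiveRoot_centerPhase N hk) hBAm hMBm hMAm
  -- a scalar matrix is central
  refine Subgroup.mem_center_iff.mpr fun g => Subtype.ext ?_
  change (g : Matrix (Fin N) (Fin N) ℂ) * (M : Matrix (Fin N) (Fin N) ℂ) =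
    (M : Matrix (Fin N) (Fin N) ℂ) * (g : Matrix (Fin N) (Fin N) ℂ)
  rw [hc, Matrix.mul_smul, Matrix.mul_one, Matrix.smul_mul, Matrix.one_mul]

/-- ★ **`SU(N)`: the slab with magnetic twist `ω^k·1` (`k` a unit of `ℤ/N`) on `(0,1)` and ANY non-trivial central electric twist `zE`
on `(2,3)` has no zero-action configuration**, on every box `(m₀+1) × (m₁+1) × (m₂+1) × (m₃+1)`.  ('t Hooft's non-orthogonal twist
`n₀₁ n₂₃ ≢ 0 (mod N)`; González-Arroyo 1998 §8.1; García Pérez–González-Arroyo–Okawa 2014 §2.) [cite: Gonzalezarroyo1998, §8.1] -/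
theorem no_twistedFlat_slab_specialUnitary {k : ZMod N} (hk : IsUnit k) {zE : Matrix.specialUnitaryGroup (Fin N) ℂ}
    (hEc : zE ∈ Subgroup.center (Matrix.specialUnitaryGroup (Fin N) ℂ)) (hE1 : zE ≠ 1) {m₀ m₁ m₂ m₃ : ℕ}
    (U : FinTorusSite (m₀ + 1) (m₁ + 1) (m₂ + 1) (m₃ + 1) × Fin 4 → Matrix.specialUnitaryGroup (Fin N) ℂ) :
    ¬ ∀ (x : FinTorusSite (m₀ + 1) (m₁ + 1) (m₂ + 1) (m₃ + 1)) (μ ν : Fin 4), μ < ν →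
        tHooftTwistTensor (slabTwist (suCenter N k : Matrix.specialUnitaryGroup (Fin N) ℂ) zE) x μ ν *
          finTorusPlaquette U x μ ν = 1 :=
  no_twistedFlat_slab (suCenter N k).2 hEc hE1 (fun A B M h1 h2 h3 => centralizer_central_of_suCenter hk A B M h1 h2 h3) U

end SpecialUnitary

end Summit.QuantumFields.YangMills.Cruxes.IRcof.TwistedSlab
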